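/-
Copyright (c) 2026 the pub-hodgecm-mathlib formalisation cell (harness21).  Prover seat hodgecm-mathlib-K2E4-p10 (g8), Track B «K2-LIT»,
#184♮ = hLiu418 = `stmt-HodgeConjecture-24832`; ROAD Φ of socket #41, TOP EDITION-3b FEEDER (fixed-carrier currency (B), desk K2E5-p17 (g8) 15:30:45Z): the WHITTAKER-KIND
(`det S ≠ 0`) per-`S` TERM PACKAGES at `X := H(𝔸)` for a GIVEN Fourier carrier `(νN, β)` — companion of ★ p861376 `K2LiuSiegelEisensteinWhittakerTermPackage` (carrier-generic currency (A)).
THEOREMS ONLY (no `def`, no `instance`, no notation, no named-fact hypothesis, no `sorry`); hypothesis-first.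
-/
import Summits.HodgeConjecture.HodgeConjecture.Theorems.K2LiuSiegelEisensteinWhittakerTermPackage   -- ★ p861376 §2 `differentiableOn_whittakerPackage`, `continuous_whittakerPackage`, `continuous_poleClearing`
import HarnessLib

/-!
# Crux `HLiu418`, ROAD Φ of socket #41 — `K2LiuSiegelEisensteinWhittakerTermPackageFixedCarrier`: THE WHITTAKER-KIND TERM PACKAGES AT `X := H(𝔸)`, FIXED FOURIER CARRIER
# (currency (B) of the TOP's edition 3b ★ p861373 `siegelEisensteinContinuation_of_kinds_fixedCarrier`)

Cell `hodgecm-mathlib`, crux item hLiu418 = `stmt-HodgeConjecture-24832` (helper lane `--supports … --as helper`, count-neutral), route of record `HCCMUnconditional`; squad K2 ∕ K2Liu,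
road `K2_Liu`, socket #41.  ★ p861376 `exists_whittaker_packages_fourierCoeff` delivers the KIND-W binders `hWoff`∕`hWd`∕`hWc`∕`hWcoef` + weighted growth in the CARRIER-GENERIC currency (A)
(edition 3 `siegelEisensteinContinuation_of_kinds`), building a carrier inside.  The TOP's edition 3b offers the PAYER-FRIENDLY currency (B): the carrier `(νN, β)` is a binder shared by all
kinds and `hWcoef` is stated for that carrier only — so the factors `WT S`, `G S` may be read off `whittakerDelta νN …` by the payers of rows G1–G4.  THIS FILE is the (B)-twin: same data and
proof (★ p861376 §2: holomorphy of the product, ★ Vitali continuity from the weighted growth and the coefficient's continuity AT THE GIVEN CARRIER, the Euler identity AT THE GIVEN CARRIER),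
no carrier construction, no `hdV0`∕`hdW0`.
* **`exists_whittaker_packages_fourierCoeff_fixedCarrier`**.
Sources: [KudlaRallis1994, §1]; [Tan1999, §1, §4 Prop. 4.8]; [Shimura1997, §18.3–18.5]; [MoeglinWaldspurger1995, IV.1.8–IV.1.11].
HONEST LABEL.  Count-neutral helper; `HC_CM` is proved only modulo the 7 printed citations (2 remaining named inputs: hLiu418 = `stmt-HodgeConjecture-24832`,
h413 = `stmt-HodgeConjecture-24833`) until rung 0 closes.
-/

set_option autoImplicit false
set_option linter.dupNamespace false -- the mandated namespace repeats `HodgeConjecture.HodgeConjecture`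

noncomputable section

namespace Summit.HodgeConjecture.HodgeConjecture.Cruxes.HLiu418.K2LiuSiegelEisensteinWhittakerTermPackageFixedCarrier

open Set Filter Topology Metric Complex
open scoped BigOperators Matrix ENNReal NNReal
open NumberField IsDedekindDomain MeasureTheory
open Literature.NumberTheory.Automorphic Literature.NumberTheory.GelbartRogawski1991 Literature.NumberTheory.GelbartRogawski1991.GRConstruction
open Literature.NumberTheory.K2Lit.SiegelDoubled Literature.MeasureTheory.Group
open K2LiuSiegelUnipotentFourierDefs
open K2LiuSiegelEisensteinWhittakerTermPackage (differentiableOn_whittakerPackage continuous_whittakerPackage continuous_poleClearing)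

/-- **THE WHITTAKER-KIND PACKAGES AT `X := H(𝔸)`, FIXED CARRIER (currency (B) of the TOP's edition 3b, desk K2E5-p17 (g8) 15:30:45Z).**  As
`exists_whittaker_packages_fourierCoeff`, but the Fourier carrier `(νN, β)` is a BINDER shared with the consumer: the continuity of `h ↦ (E^Δ(·; f_s))_S(h)` and the Euler identity
`(E^Δ(·; f_s))_S(h) = WT S s h·G S s h` (`det S ≠ 0`, `n∕2 < re s`) are taken FOR THAT CARRIER only (so the payer may build `WT`, `G` from `whittakerDelta νN …`), and no carrier is constructed
inside (`hdV0`∕`hdW0` not needed).  OUTPUT: `EcW` with `hWoff`, `hWd`, `hWc`, the fixed-carrier `hWcoef : ∀ S, det ↑S ≠ 0 → ∀ s h, n∕2 < s.re → EcW S s h = (∏_{p∈P}(s−p))·(E^Δ(·;f_s))_S(h)`, and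
the weighted growth `‖EcW S s h‖ ≤ C(z)·w(S)·‖h‖^A`. [cite: KudlaRallis1994, §1] [cite: Tan1999, §1 Main Theorem, §4 Prop. 4.8] [cite: Shimura1997, §18.3–18.5] [cite: MoeglinWaldspurger1995, IV.1.8–IV.1.11] -/
theorem exists_whittaker_packages_fourierCoeff_fixedCarrier
    (L : Type) [Field L] [NumberField L] [IsCMField L] {N M n : ℕ} (hn : 0 < n) (e : Fin N × Fin M ≃ Fin n)
    (dV : Fin N → L) (hdV : ∀ i, IsCMField.complexConj L (dV i) = dV i)
    (dW : Fin M → L) (hdW : ∀ i, IsCMField.complexConj L (dW i) = dW i)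
    [MeasurableSpace (unipDelta L e dV hdV dW hdW)]
    (νN : Measure (unipDelta L e dV hdV dW hdW)) (β : unipDelta L e dV hdV dW hdW → ℝ≥0∞)
    (f : ℂ → HA L e dV hdV dW hdW → ℂ)
    (WT G : skewMatrices ((IsCMField.complexConj L : L ≃ₐ[Fp L] L) : L →+* L) ((gramR L e dV hdV dW hdW).map (algebraMap (Fp L) L)) → ℂ → HA L e dV hdV dW hdW → ℂ)
    (hWTd : ∀ S (h : HA L e dV hdV dW hdW), DifferentiableOn ℂ (fun s => WT S s h) {s : ℂ | 0 < s.re})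
    (hGd : ∀ S (h : HA L e dV hdV dW hdW), DifferentiableOn ℂ (fun s => G S s h) {s : ℂ | 0 < s.re})
    (w : skewMatrices ((IsCMField.complexConj L : L ≃ₐ[Fp L] L) : L →+* L) ((gramR L e dV hdV dW hdW).map (algebraMap (Fp L) L)) → ℝ) (hw : ∀ S, 0 ≤ w S)
    (hg : ∀ z : ℂ, 0 < z.re → ∃ C A r : ℝ, 0 ≤ C ∧ 0 ≤ A ∧ 0 < r ∧ ∀ S (s : ℂ), dist s z < r → ∀ h : HA L e dV hdV dW hdW,
      ‖WT S s h * G S s h‖ ≤ C * w S * adelicHeightGL (n + n) L (h : GL (Fin (n + n)) (AdeleRing (𝓞 L) L)) ^ A)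
    (hRKc : ∀ S : skewMatrices ((IsCMField.complexConj L : L ≃ₐ[Fp L] L) : L →+* L) ((gramR L e dV hdV dW hdW).map (algebraMap (Fp L) L)),
      (S : Matrix (Fin n) (Fin n) L).det ≠ 0 → ∀ s : ℂ, (n : ℝ) / 2 < s.re →
        Continuous fun h : HA L e dV hdV dW hdW =>
          fourierCoeffDelta L e dV hdV dW hdW νN β (S : Matrix (Fin n) (Fin n) L) (eisensteinFamilyDelta L e dV hdV dW hdW f s) h)
    (hRK : ∀ S : skewMatrices ((IsCMField.complexConj L : L ≃ₐ[Fp L] L) : L →+* L) ((gramR L e dV hdV dW hdW).map (algebraMap (Fp L) L)),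
      (S : Matrix (Fin n) (Fin n) L).det ≠ 0 → ∀ (s : ℂ) (h : HA L e dV hdV dW hdW), (n : ℝ) / 2 < s.re →
        fourierCoeffDelta L e dV hdV dW hdW νN β (S : Matrix (Fin n) (Fin n) L) (eisensteinFamilyDelta L e dV hdV dW hdW f s) h = WT S s h * G S s h)
    (P : Finset ℂ) :
    ∃ EcW : skewMatrices ((IsCMField.complexConj L : L ≃ₐ[Fp L] L) : L →+* L) ((gramR L e dV hdV dW hdW).map (algebraMap (Fp L) L)) → ℂ → HA L e dV hdV dW hdW → ℂ,
      (∀ S : skewMatrices ((IsCMField.complexConj L : L ≃ₐ[Fp L] L) : L →+* L) ((gramR L e dV hdV dW hdW).map (algebraMap (Fp L) L)),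
        (S : Matrix (Fin n) (Fin n) L).det = 0 → ∀ (s : ℂ) (h : HA L e dV hdV dW hdW), EcW S s h = 0) ∧
      (∀ S (h : HA L e dV hdV dW hdW), DifferentiableOn ℂ (fun s => EcW S s h) {s : ℂ | 0 < s.re}) ∧
      (∀ S (s : ℂ), 0 < s.re → Continuous (EcW S s)) ∧
      (∀ S : skewMatrices ((IsCMField.complexConj L : L ≃ₐ[Fp L] L) : L →+* L) ((gramR L e dV hdV dW hdW).map (algebraMap (Fp L) L)),
        (S : Matrix (Fin n) (Fin n) L).det ≠ 0 → ∀ (s : ℂ) (h : HA L e dV hdV dW hdW), (n : ℝ) / 2 < s.re →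
          EcW S s h = (∏ p ∈ P, (s - p)) *
            fourierCoeffDelta L e dV hdV dW hdW νN β (S : Matrix (Fin n) (Fin n) L) (eisensteinFamilyDelta L e dV hdV dW hdW f s) h) ∧
      (∀ z : ℂ, 0 < z.re → ∃ C A r : ℝ, 0 ≤ C ∧ 0 ≤ A ∧ 0 < r ∧ ∀ S (s : ℂ), dist s z < r → ∀ h : HA L e dV hdV dW hdW,
        ‖EcW S s h‖ ≤ C * w S * adelicHeightGL (n + n) L (h : GL (Fin (n + n)) (AdeleRing (𝓞 L) L)) ^ A) := by
  classical
  haveI : NeZero (n + n) := ⟨by omega⟩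
  set height : HA L e dV hdV dW hdW → ℝ := fun h => adelicHeightGL (n + n) L (h : GL (Fin (n + n)) (AdeleRing (𝓞 L) L)) with hheight
  have hpos : ∀ h, 0 < height h := fun h => adelicHeightGL_pos_holds (h : GL (Fin (n + n)) (AdeleRing (𝓞 L) L))
  have hHc : Continuous height := continuous_adelicHeightGL.comp continuous_subtype_val
  have hcpt : ∀ K : Set (HA L e dV hdV dW hdW), IsCompact K → ∃ B : ℝ, ∀ h ∈ K, height h ≤ B := fun K hK => by
    obtain ⟨B, hB⟩ := hK.bddAbove_image hHc.continuousOn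
    exact ⟨B, fun h hh => hB ⟨h, hh, rfl⟩⟩
  have hgS : ∀ S, ∀ z : ℂ, 0 < z.re → ∃ C A r : ℝ, 0 ≤ C ∧ 0 ≤ A ∧ 0 < r ∧ ∀ s : ℂ, dist s z < r → ∀ h,
      ‖WT S s h * G S s h‖ ≤ C * height h ^ A := fun S z hz => by
    obtain ⟨C, A, r, hC, hA, hr, hle⟩ := hg z hz
    exact ⟨C * w S, A, r, mul_nonneg hC (hw S), hA, hr, fun s hs h => hle S s hs h⟩
  have hc : (0 : ℝ) ≤ (n : ℝ) / 2 := by positivity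
  refine ⟨fun S s h => if (S : Matrix (Fin n) (Fin n) L).det = 0 then 0 else (∏ p ∈ P, (s - p)) * (WT S s h * G S s h),
    fun S hS s h => by simp only [hS, ↓reduceIte], fun S h => ?_, fun S s hs => ?_, fun S hS s h hs => ?_, fun z hz => ?_⟩
  · by_cases hS : (S : Matrix (Fin n) (Fin n) L).det = 0
    · simp only [hS, ↓reduceIte]; exact differentiableOn_const 0
    · simp only [hS, ↓reduceIte]; exact differentiableOn_whittakerPackage (WT S) (G S) (hWTd S) (hGd S) P h
  · by_cases hS : (S : Matrix (Fin n) (Fin n) L).det = 0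
    · simp only [hS, ↓reduceIte]; exact continuous_const
    · simp only [hS, ↓reduceIte]
      exact continuous_whittakerPackage height hpos hcpt (WT S) (hWTd S) (G S) (hGd S) (hgS S) hc
        (fun s h => fourierCoeffDelta L e dV hdV dW hdW νN β (S : Matrix (Fin n) (Fin n) L) (eisensteinFamilyDelta L e dV hdV dW hdW f s) h)
        (fun s hs => hRKc S hS s hs) (fun s h hs => hRK S hS s h hs) P hs
  · simp only [hS, ↓reduceIte]
    rw [hRK S hS s h hs]
  · obtain ⟨C, A, r, hC, hA, hr, hle⟩ := hg z hz
    obtain ⟨δ, hδ, hd⟩ := Metric.continuousAt_iff.1 (continuous_poleClearing P).continuousAt 1 one_pos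
    refine ⟨(‖∏ p ∈ P, (z - p)‖ + 1) * C, A, min r δ, by positivity, hA, lt_min hr hδ, fun S s hs h => ?_⟩
    have hnn : 0 ≤ (‖∏ p ∈ P, (z - p)‖ + 1) * C * w S * height h ^ A := by
      have := hw S; have := (hpos h).le; positivity
    by_cases hS : (S : Matrix (Fin n) (Fin n) L).det = 0
    · simp only [hS, ↓reduceIte, norm_zero]; exact hnn
    · simp only [hS, ↓reduceIte]
      have ha' : ‖∏ p ∈ P, (s - p)‖ ≤ ‖∏ p ∈ P, (z - p)‖ + 1 := by
        have h1 : dist (∏ p ∈ P, (s - p)) (∏ p ∈ P, (z - p)) < 1 := hd (lt_of_lt_of_le hs (min_le_right _ _))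
        rw [dist_eq_norm] at h1
        calc ‖∏ p ∈ P, (s - p)‖ = ‖(∏ p ∈ P, (z - p)) + ((∏ p ∈ P, (s - p)) - ∏ p ∈ P, (z - p))‖ := by rw [add_sub_cancel]
          _ ≤ ‖∏ p ∈ P, (z - p)‖ + ‖(∏ p ∈ P, (s - p)) - ∏ p ∈ P, (z - p)‖ := norm_add_le _ _
          _ ≤ ‖∏ p ∈ P, (z - p)‖ + 1 := by linarith
      calc ‖(∏ p ∈ P, (s - p)) * (WT S s h * G S s h)‖ = ‖∏ p ∈ P, (s - p)‖ * ‖WT S s h * G S s h‖ := norm_mul _ _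
        _ ≤ (‖∏ p ∈ P, (z - p)‖ + 1) * (C * w S * height h ^ A) :=
            mul_le_mul ha' (hle S s (lt_of_lt_of_le hs (min_le_left _ _)) h) (norm_nonneg _) (by positivity)
        _ = (‖∏ p ∈ P, (z - p)‖ + 1) * C * w S * height h ^ A := by ring

end Summit.HodgeConjecture.HodgeConjecture.Cruxes.HLiu418.K2LiuSiegelEisensteinWhittakerTermPackageFixedCarrier

end
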